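import Mathlib
import Summits.NavierStokesRegularity.NavierStokesRegularity.Theorems.AxisTwistDoorAveragedConeLiouvilleDefs
import Summits.NavierStokesRegularity.NavierStokesRegularity.Theorems.AxisTwistDoorAveragedConeLiouvilleCircleToolkit
import Summits.NavierStokesRegularity.NavierStokesRegularity.Theorems.AxisTwistDoorAveragedConeLiouvilleCircMonotone
import Summits.NavierStokesRegularity.NavierStokesRegularity.Theorems.AxisTwistDoorAveragedConeLiouvilleRescale
import Summits.NavierStokesRegularity.NavierStokesRegularity.Theorems.AxisTwistDoorAveragedConeLiouvilleUnitContraction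
import Summits.NavierStokesRegularity.NavierStokesRegularity.Theorems.AxisTwistDoorAveragedConeLiouvilleGamma34
import Summits.NavierStokesRegularity.NavierStokesRegularity.Theorems.AxisTwistDoorAveragedConeLiouvilleCircleSwirl
import HarnessLib

/-!
# AxisTwistDoor · crux `AveragedConeLiouville` (stmt-NavierStokesRegularity-26889) · line `lrt_shell`, stub (5a)
# `stub_shellSupersolution : ShellSupersolution` — the UNIFORM FLUX BOUND `Γ ≤ Γ*(I₀)` on the unit window from the
# regular shell of the ZOOMED-OUT profile, the Type-I circle bound, and the assembled axis-circulation data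

Lei–Ren–Tian, arXiv:2501.08976, §4 p. 11 (first display: "`Γ ≤ Γ*` on `𝒬(1)` by the regular shell and the
monotonicity of `Γ` in `r`").  For a profile `w` of the route's energy class with `ω₃ ≥ 0`:

* `norm_le_half_of_shell_nsRescale_two` — if the zoomed-out profile `u = nsRescale 2 w` (`u(t,x) = 2w(4t,2x)`, again
  in the class with the same `𝐈`) has `|u| ≤ B` on the cylindrical shell `{a−δ < r < a+δ, |z| < a+δ}` for
  `−(a+δ)² < t < 0` (the conclusion of `ShellFact`), then `|w| ≤ B/2` on the DOUBLED shell
  `{2(a−δ) < r < 2(a+δ), |z| < 2(a+δ)}` for `−4(a+δ)² < s < 0`;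
* `circ_le_of_shellFact` — **`Γ_w(r,z,s) ≤ Γ* := 2π·(4/5)·B(I₀)`** for `−16/9 < s < 0`, `0 ≤ r ≤ 4/3`, `|z| < 4/3`
  (so on all of `𝒬(1)`), for EVERY class profile `w` with `𝐈 ≤ I₀` and the sign: `Γ_w(r,z,s) ≤ Γ_w(2a,z,s)`
  (monotonicity in `r`, `…CircMonotone.circ_mono`, `2a > 4/3`) `≤ 2π(2a)(B/2)` (`…CircleToolkit.abs_circ_le`);
* `abs_circ_le_typeI` — `|Γ_w(r,z,s)| ≤ 2π r C/√(−s)` from the Type-I rate alone;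
* `norm_le_of_typeI_of_le` — `|w(s,y)| ≤ C/√(−s₀)` for `s ≤ s₀ < 0` (the "early slab" velocity bound that, together
  with the shell bound, feeds the drift constant of eq. Gamma-34, `…Gamma34.gamma34_on_circle`);
* `stub_shellSupersolution` — **the registered stub (5a) `ShellSupersolution` (brick F4's Prop, VERBATIM)**: for
  `K ≥ 0`, `C`, `I₀ < ∞` the data `δ₀` (Lei–Ren's shell width), `C_d := (B + 2 max(C,0))(1+K)`, `A := 2π max(C,0)`,
  `Γ* := 2π(4/5)B` such that every class profile with `𝐈 ≤ I₀`, `ω₃ ≥ 0` and the slack-free cone with constant `K`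
  has `AxisCirculationData (circ w) δ₀ C_d A Γ*`: (H1) `Γ ∈ C²` (toolkit), (H2) `0 ≤ Γ ↑` in `r` (`…CircMonotone`),
  (H3) `circ_le_of_shellFact`, (H4) `circ_le_typeI`, (H5) eq. Gamma-34 on the lateral shell ∪ early slab of the
  profile's OWN Lei–Ren shell `(a, δ)` (`…Gamma34.gamma34_on_circle` with the velocity bound `B + 2 max(C,0)`:
  `|w| ≤ B` on the shell, `|w| ≤ C/√(−s) < 2C` for `s < −(a−δ)²` as `a − δ > 17/30 > 1/2`; the swirl identity is
  stub (1), `…CircleSwirl.stub_circleSwirl`).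

Seat ns-el-k1b g0 (width seat; LEAD ns-atd-p1 assigns (5a) `stub_shellSupersolution`).  WHAT THIS IS NOT: not a
statement about Navier–Stokes regularity; elementary bricks about HYPOTHETICAL Type-I blow-up profiles for a STAGED
door route (ACL, item 26991 and the leaf remain open).  [cite: LeiRenTian2025, §4 p. 11; LeiRen2024, Thm 2]
-/

noncomputable section

-- the summit and its single sub-problem share the name (CONVENTIONS §1), as in every Theorems file
set_option linter.dupNamespace false

namespace Summit.NavierStokesRegularity.NavierStokesRegularity.Theorems.AveragedConeLiouville.ShellBound

open scoped Topology InnerProductSpace NNReal ENNReal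
open Set Function MeasureTheory Filter Metric
open Literature.Analysis
open Literature.Analysis.FluidPDE hiding eR
open Summit.NavierStokesRegularity.NavierStokesRegularity.Theorems
open Summit.NavierStokesRegularity.NavierStokesRegularity.Theorems.AxisTwistDoorAveragedConeLiouvilleDefs
open Summit.NavierStokesRegularity.NavierStokesRegularity.Theorems.AxisTwistDoorAveragedConeLiouvilleCircleToolkit
  (abs_circ_le contDiff_slice)
open Summit.NavierStokesRegularity.NavierStokesRegularity.Theorems.AxisTwistDoorAveragedConeLiouvilleRescale
  (inClass_nsRescale typeIBound_inClass_nsRescale smul_cylPt)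
open Summit.NavierStokesRegularity.NavierStokesRegularity.Theorems.AveragedConeLiouville.CircMonotone (circ_mono circ_nonneg)

variable {C : ℝ} {w : ℝ → EuclideanSpace ℝ (Fin 3) → EuclideanSpace ℝ (Fin 3)}
  {ϖ : ℝ → EuclideanSpace ℝ (Fin 3) → ℝ}
  {G : ℝ → EuclideanSpace ℝ (Fin 3) → EuclideanSpace ℝ (Fin 3) →L[ℝ] EuclideanSpace ℝ (Fin 3)}

/-! ### from the shell of the zoomed-out profile to the doubled shell of the profile -/

/-- `w(s)(P(r,θ,z)) = ½ · u(s/4)(P(r/2,θ,z/2))` for `u = nsRescale 2 w`. -/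
theorem eq_half_nsRescale_two (w : ℝ → EuclideanSpace ℝ (Fin 3) → EuclideanSpace ℝ (Fin 3)) (s r θ z : ℝ) :
    w s (cylPt r θ z) = (1 / 2 : ℝ) • nsRescale 2 w (s / 4) (cylPt (r / 2) θ (z / 2)) := by
  rw [nsRescale_apply, smul_cylPt, smul_smul]
  have e1 : (2 : ℝ) ^ 2 * (s / 4) = s := by ring
  have e2 : (2 : ℝ) * (r / 2) = r := by ring
  have e3 : (2 : ℝ) * (z / 2) = z := by ring
  rw [e1, e2, e3]
  norm_num

/-- **Velocity bound on the doubled shell.**  If `u = nsRescale 2 w` satisfies `|u(t)(P(r,θ,z))| ≤ B` for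
`−(a+δ)² < t < 0`, `a−δ < r < a+δ`, `|z| < a+δ`, then `|w(s)(P(r,θ,z))| ≤ B/2` for `−4(a+δ)² < s < 0`,
`2(a−δ) < r < 2(a+δ)`, `|z| < 2(a+δ)`. -/
theorem norm_le_half_of_shell_nsRescale_two {a δ B : ℝ}
    (hu : ∀ t : ℝ, -(a + δ) ^ 2 < t → t < 0 → ∀ r θ z : ℝ, a - δ < r → r < a + δ → |z| < a + δ →
      ‖nsRescale 2 w t (cylPt r θ z)‖ ≤ B)
    {s : ℝ} (hs1 : -(4 * (a + δ) ^ 2) < s) (hs : s < 0) {r : ℝ} (hr1 : 2 * (a - δ) < r) (hr2 : r < 2 * (a + δ))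
    (θ : ℝ) {z : ℝ} (hz : |z| < 2 * (a + δ)) :
    ‖w s (cylPt r θ z)‖ ≤ B / 2 := by
  have h := hu (s / 4) (by nlinarith) (by linarith) (r / 2) θ (z / 2) (by linarith) (by linarith)
    (by rw [abs_div, abs_two]; linarith)
  rw [eq_half_nsRescale_two w s r θ z, norm_smul, Real.norm_of_nonneg (by norm_num : (0 : ℝ) ≤ 1 / 2)]
  linarith

/-! ### the uniform flux bound on the unit window -/

/-- **`Γ ≤ Γ*(I₀)` ON THE UNIT WINDOW, UNIFORMLY IN THE PROFILE** (LRT §4 p. 11).  Given the class-specialised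
regular-shell fact `ShellFact` and a bound `I₀ < ∞`, there is `Γ* ≥ 0` such that every class profile `w` with
`𝐈(w) ≤ I₀` and `ω₃ ≥ 0` has `Γ_w(r,z,s) ≤ Γ*` for `−16/9 < s < 0`, `0 ≤ r ≤ 4/3`, `|z| < 4/3`: apply `ShellFact` to
the zoomed-out profile `nsRescale 2 w` (same class constant, same `𝐈`), halve (`norm_le_half_of_shell_nsRescale_two`),
and use the monotonicity of `Γ` in `r` up to the radius `2a ∈ (4/3, 8/5)` and `|Γ(2a,z,s)| ≤ 2π(2a)(B/2)`. -/
theorem circ_le_of_shellFact (hS : ShellFact) {I₀ : ℝ≥0∞} (hI₀ : I₀ < ⊤) :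
    ∃ Γstar : ℝ, 0 ≤ Γstar ∧
      ∀ (C : ℝ) (w : ℝ → EuclideanSpace ℝ (Fin 3) → EuclideanSpace ℝ (Fin 3))
        (ϖ : ℝ → EuclideanSpace ℝ (Fin 3) → ℝ)
        (G : ℝ → EuclideanSpace ℝ (Fin 3) → EuclideanSpace ℝ (Fin 3) →L[ℝ] EuclideanSpace ℝ (Fin 3)),
        InClass C w ϖ G → typeIBound (Iio (0 : ℝ) ×ˢ univ) w ϖ G ≤ I₀ → SignE3 w →
        ∀ s : ℝ, -(16 / 9 : ℝ) < s → s < 0 → ∀ r : ℝ, 0 ≤ r → r ≤ 4 / 3 → ∀ z : ℝ, |z| < 4 / 3 →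
          circ w r z s ≤ Γstar := by
  obtain ⟨δ₀, B, hδ₀, hB, hshell⟩ := hS I₀ hI₀
  refine ⟨2 * Real.pi * (4 / 5) * B, by positivity, fun C w ϖ G hcl hI hsign s hs1 hs r hr0 hr1 z hz => ?_⟩
  -- the regular shell of the zoomed-out profile
  have hcl2 := inClass_nsRescale hcl (δ := 2) two_pos
  have hI2 : typeIBound (Iio (0 : ℝ) ×ˢ univ) (nsRescale 2 w) ((2 : ℝ) ^ 2 • stPull ((2 : ℝ) ^ 2) 2 0 0 ϖ)
      ((2 : ℝ) ^ 2 • stPull ((2 : ℝ) ^ 2) 2 0 0 G) ≤ I₀ := by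
    rw [typeIBound_inClass_nsRescale two_pos]; exact hI
  obtain ⟨a, δ, ha1, ha2, hδ1, hδ2, hu⟩ := hshell C _ _ _ hcl2 hI2
  have hδ0 : 0 < δ := hδ₀.trans_le hδ1
  -- `|w(s)| ≤ B/2` on the circle of radius `2a` at height `z`
  have hwB : ∀ θ : ℝ, ‖w s (cylPt (2 * a) θ z)‖ ≤ B / 2 := fun θ =>
    norm_le_half_of_shell_nsRescale_two (fun t ht1 ht2 r' θ' z' h1 h2 h3 => (hu t ht1 ht2 r' θ' z' h1 h2 h3).1)
      (by nlinarith) hs (by linarith) (by linarith) θ (by linarith)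
  -- monotonicity up to the radius `2a > 4/3 ≥ r`, then the circle bound
  have h1 : ContDiff ℝ 1 (w s) := (contDiff_slice hcl hs).of_le (by exact_mod_cast le_top)
  calc circ w r z s ≤ circ w (2 * a) z s := circ_mono w h1 hsign hs hr0 (by linarith) z
    _ ≤ |circ w (2 * a) z s| := le_abs_self _
    _ ≤ 2 * Real.pi * (2 * a) * (B / 2) := abs_circ_le (by linarith) hwB
    _ = 2 * Real.pi * a * B := by ring
    _ ≤ 2 * Real.pi * (4 / 5) * B := by gcongr

/-- The same bound packaged on the apex windows `𝒬(ρ)`, `ρ ≤ 4/3`, in the `CircBoundOn` vocabulary of brick F1. -/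
theorem circBoundOn_of_shellFact (hS : ShellFact) {I₀ : ℝ≥0∞} (hI₀ : I₀ < ⊤) :
    ∃ Γstar : ℝ, 0 ≤ Γstar ∧
      ∀ (C : ℝ) (w : ℝ → EuclideanSpace ℝ (Fin 3) → EuclideanSpace ℝ (Fin 3))
        (ϖ : ℝ → EuclideanSpace ℝ (Fin 3) → ℝ)
        (G : ℝ → EuclideanSpace ℝ (Fin 3) → EuclideanSpace ℝ (Fin 3) →L[ℝ] EuclideanSpace ℝ (Fin 3)),
        InClass C w ϖ G → typeIBound (Iio (0 : ℝ) ×ˢ univ) w ϖ G ≤ I₀ → SignE3 w →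
        ∀ ρ : ℝ, ρ ≤ 4 / 3 → AxisTwistDoorAveragedConeLiouvilleFluxIteration.CircBoundOn w ρ Γstar := by
  obtain ⟨Γstar, h0, h⟩ := circ_le_of_shellFact hS hI₀
  refine ⟨Γstar, h0, fun C w ϖ G hcl hI hsign ρ hρ s r z hs1 hs hr hrρ hz => ?_⟩
  have hρ2 : ρ ^ 2 ≤ (4 / 3) ^ 2 := by
    have hρ0 : 0 < ρ := hr.trans hrρ
    nlinarith
  exact h C w ϖ G hcl hI hsign s (by nlinarith) hs r hr.le (by linarith) z (by linarith)

/-! ### the Type-I circle bound and the early-slab velocity bound -/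

/-- **`|Γ_w(r,z,s)| ≤ 2π r · C/√(−s)`** from the Type-I rate alone. -/
theorem abs_circ_le_typeI (hrate : HasTypeITimeDecay C w) {s : ℝ} (hs : s < 0) {r : ℝ} (hr : 0 < r) (z : ℝ) :
    |circ w r z s| ≤ 2 * Real.pi * r * (C / Real.sqrt (-s)) :=
  abs_circ_le hr fun _ => hrate s hs _

/-- `Γ_w(r,z,s) ≤ 2π C · r/√(−s)` (the form (H4) of the Harnack chain). -/
theorem circ_le_typeI (hrate : HasTypeITimeDecay C w) {s : ℝ} (hs : s < 0) {r : ℝ} (hr : 0 < r) (z : ℝ) :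
    circ w r z s ≤ 2 * Real.pi * C * (r / Real.sqrt (-s)) := by
  have h := (le_abs_self _).trans (abs_circ_le_typeI hrate hs hr z)
  calc circ w r z s ≤ 2 * Real.pi * r * (C / Real.sqrt (-s)) := h
    _ = 2 * Real.pi * C * (r / Real.sqrt (-s)) := by ring

/-- **Early-slab velocity bound**: `|w(s,y)| ≤ C/√(−s₀)` for `s ≤ s₀ < 0`. -/
theorem norm_le_of_typeI_of_le (hrate : HasTypeITimeDecay C w) {s₀ s : ℝ} (hs₀ : s₀ < 0) (hs : s ≤ s₀)
    (y : EuclideanSpace ℝ (Fin 3)) : ‖w s y‖ ≤ C / Real.sqrt (-s₀) := by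
  have hC : 0 ≤ C := by
    have h := hrate (-1) (by norm_num) 0
    rw [neg_neg, Real.sqrt_one, div_one] at h
    exact (norm_nonneg _).trans h
  have hslt : s < 0 := lt_of_le_of_lt hs hs₀
  refine (hrate s hslt y).trans ?_
  exact div_le_div_of_nonneg_left hC (Real.sqrt_pos.2 (neg_pos.2 hs₀)) (Real.sqrt_le_sqrt (by linarith))

/-- The combined DRIFT VELOCITY BOUND of eq. Gamma-34: on the doubled shell of `w` (from `ShellFact` for
`nsRescale 2 w`) `|w| ≤ B/2 ≤ B + C/√(−s₀)`, and on the early slab `s ≤ s₀` `|w| ≤ C/√(−s₀) ≤ B + C/√(−s₀)`. -/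
theorem norm_le_shell_or_early {a δ B : ℝ} (hB : 0 ≤ B)
    (hu : ∀ t : ℝ, -(a + δ) ^ 2 < t → t < 0 → ∀ r θ z : ℝ, a - δ < r → r < a + δ → |z| < a + δ →
      ‖nsRescale 2 w t (cylPt r θ z)‖ ≤ B)
    (hrate : HasTypeITimeDecay C w) {s₀ : ℝ} (hs₀ : s₀ < 0)
    {s : ℝ} (hs : s < 0) {r : ℝ} (θ : ℝ) {z : ℝ}
    (h : (-(4 * (a + δ) ^ 2) < s ∧ 2 * (a - δ) < r ∧ r < 2 * (a + δ) ∧ |z| < 2 * (a + δ)) ∨ s ≤ s₀) :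
    ‖w s (cylPt r θ z)‖ ≤ B + C / Real.sqrt (-s₀) := by
  have hC : 0 ≤ C / Real.sqrt (-s₀) := by
    have h1 := norm_le_of_typeI_of_le hrate hs₀ le_rfl 0
    exact (norm_nonneg _).trans h1
  rcases h with ⟨h1, h2, h3, h4⟩ | hearly
  · have := norm_le_half_of_shell_nsRescale_two hu h1 hs h2 h3 θ h4
    linarith
  · have := norm_le_of_typeI_of_le hrate hs₀ hearly (cylPt r θ z)
    linarith

/-! ### stub (5a): the axis-circulation data of a class profile -/

/-- The drift velocity bound on the profile's own Lei–Ren shell ∪ early slab: `|w(s)| ≤ B + 2 max(C,0)` on every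
circle `S(r,z)` with `0 < r < a+δ`, `|z| < a+δ`, `−(a+δ)² < s < 0` and (`a−δ < r` or `s < −(a−δ)²`). -/
theorem norm_le_on_shell_or_early {a δ B : ℝ} (hB : 0 ≤ B) (haδ : 1 / 2 < a - δ)
    (hw : ∀ t : ℝ, -(a + δ) ^ 2 < t → t < 0 → ∀ r θ z : ℝ, a - δ < r → r < a + δ → |z| < a + δ →
      ‖w t (cylPt r θ z)‖ ≤ B)
    (hrate : HasTypeITimeDecay C w) {s r z : ℝ} (hs1 : -(a + δ) ^ 2 < s) (hs : s < 0) (hra : r < a + δ)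
    (hz : |z| < a + δ) (hreg : a - δ < r ∨ s < -(a - δ) ^ 2) (θ : ℝ) :
    ‖w s (cylPt r θ z)‖ ≤ B + 2 * max C 0 := by
  have hC0 : 0 ≤ max C 0 := le_max_right _ _
  rcases hreg with h | h
  · exact (hw s hs1 hs r θ z h hra hz).trans (le_add_of_nonneg_right (by positivity))
  · -- early slab: `√(−s) > a − δ > 1/2`
    have hms : 0 < -s := neg_pos.2 hs
    have hsq : 1 / 2 < Real.sqrt (-s) := by
      have h1 : (a - δ) ^ 2 < -s := by linarith
      have h2 : a - δ < Real.sqrt (-s) := by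
        rw [← Real.sqrt_sq (by linarith : (0 : ℝ) ≤ a - δ)]
        exact Real.sqrt_lt_sqrt (sq_nonneg _) h1
      linarith
    have h1 := hrate s hs (cylPt r θ z)
    have h2 : C / Real.sqrt (-s) ≤ max C 0 / Real.sqrt (-s) :=
      div_le_div_of_nonneg_right (le_max_left _ _) (Real.sqrt_nonneg _)
    have h3 : max C 0 / Real.sqrt (-s) ≤ max C 0 / (1 / 2) :=
      div_le_div_of_nonneg_left hC0 (by norm_num) hsq.le
    have h4 : max C 0 / (1 / 2) = 2 * max C 0 := by ring
    linarith

/-- **Stub (5a) `stub_shellSupersolution : ShellSupersolution` of `Cruxes/AveragedConeLiouville/Lines/lrt_shell.lean` (v6)**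
(the type of this declaration is literally `…AxisTwistDoorAveragedConeLiouvilleUnitContraction.ShellSupersolution`).
THE AXIS-CIRCULATION DATA OF A CLASS PROFILE FROM THE REGULAR SHELL: given `ShellFact`, for `K ≥ 0`, `C`, `I₀ < ∞` take
Lei–Ren's `δ₀`, `B` for `I₀` and `C_d := (B + 2 max(C,0))(1+K)`, `A := 2π max(C,0)`, `Γ* := 2π(4/5)B`; then every
class profile `w` with `𝐈 ≤ I₀`, `ω₃ ≥ 0` and the slack-free cone with constant `K` has
`AxisCirculationData (circ w) δ₀ C_d A Γ*` — (H1) toolkit, (H2) `…CircMonotone`, (H3) `circ_le_of_shellFact`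
(zoomed-out shell), (H4) `circ_le_typeI`, (H5) `…Gamma34.gamma34_on_circle` on the profile's own shell ∪ early slab
with the velocity bound `norm_le_on_shell_or_early` and the swirl identity of stub (1).
[cite: LeiRenTian2025, §4 p. 11; LeiRen2024, Thm 2] -/
theorem stub_shellSupersolution : AxisTwistDoorAveragedConeLiouvilleUnitContraction.ShellSupersolution := by
  intro hS K C I₀ hK hI₀
  obtain ⟨δ₀, B, hδ₀, hB, hshell⟩ := hS I₀ hI₀
  obtain ⟨Γstar, hΓ0, hΓ⟩ := circ_le_of_shellFact hS hI₀
  have hC0 : 0 ≤ max C 0 := le_max_right _ _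
  refine ⟨δ₀, (B + 2 * max C 0) * (1 + K), 2 * Real.pi * max C 0, Γstar, hδ₀, by positivity, by positivity, hΓ0,
    fun w ϖ G hcl hI hsign hcone => ?_⟩
  have h1 : ∀ s : ℝ, s < 0 → ContDiff ℝ 1 (w s) := fun s hs =>
    (contDiff_slice hcl hs).of_le (by exact_mod_cast le_top)
  have hcse : CircleSwirlEquation w :=
    AveragedConeLiouville.CircleSwirl.stub_circleSwirl C w ϖ G hcl.decay hcl.cont hcl.mild hcl.divFree hcl.suitable
      hcl.weakGrad hcl.typeI
  refine ⟨(AxisTwistDoorAveragedConeLiouvilleCircleToolkit.stub_circleToolkit C w ϖ G hcl).1, ?_, ?_, ?_, ?_⟩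
  · -- (H2) sign and monotonicity in `r`
    intro s hs z r₁ r₂ h0 h12
    exact ⟨circ_nonneg w (h1 s hs) hsign hs h0 z, circ_mono w (h1 s hs) hsign hs h0 h12 z⟩
  · -- (H3) the uniform bound on the unit window
    intro s r z hs1 hs hr hr1 hz
    have hs1' : (-(16 / 9) : ℝ) < s := by norm_num at hs1; linarith
    exact hΓ C w ϖ G hcl hI hsign s hs1' hs r hr.le (by linarith) z (by linarith)
  · -- (H4) the Type-I bound
    intro s hs r hr z
    rcases hr.eq_or_lt with h | h
    · rw [← h, AveragedConeLiouville.CircMonotone.circ_zero, mul_zero, zero_div]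
    · calc circ w r z s ≤ 2 * Real.pi * C * (r / Real.sqrt (-s)) := circ_le_typeI hcl.decay hs h z
        _ ≤ 2 * Real.pi * max C 0 * (r / Real.sqrt (-s)) := by
            gcongr
            exact le_max_left _ _
        _ = 2 * Real.pi * max C 0 * r / Real.sqrt (-s) := by ring
  · -- (H5) eq. Gamma-34 on the profile's own shell ∪ early slab
    obtain ⟨a, δ, ha1, ha2, hδ1, hδ2, hw⟩ := hshell C w ϖ G hcl hI
    refine ⟨a, δ, ha1, ha2, hδ1, hδ2, fun s r z hs1 hs hr hra hz hreg => ?_⟩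
    have haδ : 1 / 2 < a - δ := by linarith
    have hB₁ : ∀ θ : ℝ, ‖w s (cylPt r θ z)‖ ≤ B + 2 * max C 0 := fun θ =>
      norm_le_on_shell_or_early hB haδ (fun t ht1 ht2 r' θ' z' h1' h2' h3' => (hw t ht1 ht2 r' θ' z' h1' h2' h3').1)
        hcl.decay hs1 hs hra hz hreg θ
    exact AxisTwistDoorAveragedConeLiouvilleGamma34.gamma34_on_circle hcl hsign hcse hs hr (hcone s hs r hr z) hB₁

end Summit.NavierStokesRegularity.NavierStokesRegularity.Theorems.AveragedConeLiouville.ShellBound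

end
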